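import Mathlib
import HarnessLib
import Summits.HubbardSuperconductivity.HubbardSuperconductivity.Theorems.ChiralWindowCwKLChiralWindowHausdorffFinite
import Summits.HubbardSuperconductivity.HubbardSuperconductivity.Theorems.WeakCouplingBCSKlCertTPrimeFiniteMeasure
import Summits.HubbardSuperconductivity.HubbardSuperconductivity.Theorems.WeakCouplingBCSKlCertTPrimeLeafReductions

/-!
# Route `WeakCouplingBCS` — the Fermi curve of EVERY `t`–`t′` band at EVERY level has finite length, and its measure is finite from a speed floor alone
# (the analytic leaf «HausdorffFinite-tp» of «(KLSCAN)-TPRIME-SOUNDNESS», UNCONDITIONAL; certificate half of stmt-HubbardSuperconductivity-0158; seat p4 g19)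

The registered leaf `stub_klHausdorffFinite` proves `μH[1] F < ∞` for `ε₀ = squareDispersion 1 0`, `μ ∈ (-4, 0)` by four explicit `1`-Lipschitz arcs.  For the
`t`–`t′` band a slope bound depends on `(t′, μ)` and degenerates at the band edges and the van Hove level.  This file avoids slopes altogether:

* §1 **the graph of a monotone (or antitone) function `h` on ANY set `D ⊆ [a, b]` with values in `[c, d]` has `μH[1] ≤ (b − a) + (d − c)`**
  (`klph_hausdorffMeasure_graph_le`): it is the image of `S = {x ± h x : x ∈ D} ⊆` an interval of that length under a `1`-Lipschitz map
  (`s ↦ (x(s), h(x(s)))` — both coordinates move by at most `|Δs|`);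
* §2 on the Fermi curve `cos k₁ · (1 + 2t′ cos k₀) = −μ/2 − cos k₀`, so off the (at most two) abscissae with `1 + 2t′cos k₀ = 0` one has
  `k₁ = ± arccos g(k₀)`, `g(x) = (−μ/2 − cos x)/(1 + 2t′ cos x)` — a Möbius function of `cos x`, hence MONOTONE OR ANTITONE on each of the four pieces
  `{x ∈ [0, π] or [−π, 0]} ∩ {1 + 2t′cos x > 0 or < 0}` (`klph_monoOrAnti_arccos_g`), whatever `(t′, μ)`; the exceptional abscissae contribute at most two
  vertical segments;
* §3 **`klph_hausdorffMeasure_fermiCurve_le` / `_lt_top`: `μH[1] (fermiCurve (squareDispersion 1 tp) μ) ≤ 10·(2π) < ∞` for every `tp`, `μ`**, and hence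
  **`klph_isFiniteMeasure_tp_of_speedSqFloor'`**: the Fermi-curve measure `σ[ε_{t′}, μ]` is finite as soon as a speed floor
  `0 < w ≤ ‖∇ε_{t′}‖²` holds on the Fermi curve (the one row an interval engine certifies per scan cell, off the van Hove level).

No definitions; nothing asserts a margin, a window or superconductivity.
References: S. Raghu, S. A. Kivelson, D. J. Scalapino, Phys. Rev. B 81 (2010) 224505, §II (6), (8).
-/

noncomputable section

-- the tree's namespace `Summit.<Summit>.<Problem>.Theorems` repeats the summit name by design (D-0017)
set_option linter.dupNamespace false

namespace Summit.HubbardSuperconductivity.HubbardSuperconductivity.Theorems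

open MeasureTheory Set Real Literature.MathematicalPhysics.QuantumLattice
open scoped ENNReal NNReal

/-! ### §1 Graphs of monotone functions have finite length -/

/-- **Core**: if `φ : ℝ → ℝ` dominates the `ℓ¹` displacement of the graph of `h` on `D` (`|x − x′| + |h x − h x′| ≤ |φ x − φ x′|`) and `φ(D) ⊆ [lo, hi]`,
then the graph `{(x, h x) : x ∈ D} ⊆ ℝ²` has `μH[1] ≤ hi − lo` (it is a `1`-Lipschitz image of `φ(D)`). [folklore] -/
theorem klph_hausdorffMeasure_graph_le_core {h φ : ℝ → ℝ} {D : Set ℝ} {lo hi : ℝ}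
    (hineq : ∀ x ∈ D, ∀ x' ∈ D, |x - x'| + |h x - h x'| ≤ |φ x - φ x'|) (hφ : φ '' D ⊆ Icc lo hi) :
    μH[1] ((fun x => (WithLp.toLp 2 ![x, h x] : Momentum)) '' D) ≤ ENNReal.ofReal (hi - lo) := by
  classical
  set S := φ '' D with hS
  set ψ : ℝ → Momentum := fun s => WithLp.toLp 2 ![Function.invFunOn φ D s, h (Function.invFunOn φ D s)] with hψ
  have hinv : ∀ s ∈ S, Function.invFunOn φ D s ∈ D ∧ φ (Function.invFunOn φ D s) = s := fun s hs => by
    obtain ⟨x, hx, rfl⟩ := hs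
    exact ⟨Function.invFunOn_mem ⟨x, hx, rfl⟩, Function.invFunOn_eq ⟨x, hx, rfl⟩⟩
  -- the graph is the image of `S` under `ψ`
  have hsub : (fun x => (WithLp.toLp 2 ![x, h x] : Momentum)) '' D ⊆ ψ '' S := by
    rintro _ ⟨x, hx, rfl⟩
    refine ⟨φ x, ⟨x, hx, rfl⟩, ?_⟩
    obtain ⟨hmem, heq⟩ := hinv (φ x) ⟨x, hx, rfl⟩
    have hxx : Function.invFunOn φ D (φ x) = x := by
      have h1 := hineq _ hmem x hx
      rw [heq, sub_self, abs_zero] at h1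
      have : |Function.invFunOn φ D (φ x) - x| = 0 :=
        le_antisymm (by linarith [abs_nonneg (h (Function.invFunOn φ D (φ x)) - h x)]) (abs_nonneg _)
      exact sub_eq_zero.1 (abs_eq_zero.1 this)
    simp only [hψ, hxx]
  -- `ψ` is `1`-Lipschitz on `S`
  have hLip : LipschitzOnWith 1 ψ S := by
    refine LipschitzOnWith.of_dist_le_mul fun s hs s' hs' => ?_
    obtain ⟨hm, he⟩ := hinv s hs
    obtain ⟨hm', he'⟩ := hinv s' hs'
    simp only [hψ, NNReal.coe_one, one_mul, Real.dist_eq]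
    calc dist (WithLp.toLp 2 ![Function.invFunOn φ D s, h (Function.invFunOn φ D s)] : Momentum)
          (WithLp.toLp 2 ![Function.invFunOn φ D s', h (Function.invFunOn φ D s')])
        ≤ |Function.invFunOn φ D s - Function.invFunOn φ D s'| + |h (Function.invFunOn φ D s) - h (Function.invFunOn φ D s')| :=
          kl_hf_dist_mk_le _ _ _ _
      _ ≤ |φ (Function.invFunOn φ D s) - φ (Function.invFunOn φ D s')| := hineq _ hm _ hm'
      _ = |s - s'| := by rw [he, he']
  calc μH[1] ((fun x => (WithLp.toLp 2 ![x, h x] : Momentum)) '' D)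
      ≤ μH[1] (ψ '' S) := measure_mono hsub
    _ ≤ (1 : ℝ≥0∞) ^ (1 : ℝ) * μH[1] S := hLip.hausdorffMeasure_image_le zero_le_one
    _ = μH[1] S := by rw [ENNReal.one_rpow, one_mul]
    _ ≤ μH[1] (Icc lo hi) := measure_mono hφ
    _ = ENNReal.ofReal (hi - lo) := by rw [hausdorffMeasure_real, Real.volume_Icc]

/-- **The graph of a monotone-or-antitone function on a set `D ⊆ [a, b]` with values in `[c, d]` has length at most `(b − a) + (d − c)`.**
[folklore] -/
theorem klph_hausdorffMeasure_graph_le {h : ℝ → ℝ} {D : Set ℝ} {a b c d : ℝ}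
    (hD : D ⊆ Icc a b) (hval : ∀ x ∈ D, h x ∈ Icc c d) (hm : MonotoneOn h D ∨ AntitoneOn h D) :
    μH[1] ((fun x => (WithLp.toLp 2 ![x, h x] : Momentum)) '' D) ≤ ENNReal.ofReal ((b - a) + (d - c)) := by
  rcases hm with hm | hm
  · -- `φ = x + h x`
    have h := klph_hausdorffMeasure_graph_le_core (h := h) (φ := fun x => x + h x) (D := D) (lo := a + c) (hi := b + d) ?_ ?_
    · rwa [show b + d - (a + c) = (b - a) + (d - c) by ring] at h
    · intro x hx x' hx'
      rcases le_total x x' with hle | hle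
      · have hh : h x ≤ h x' := hm hx hx' hle
        rw [abs_of_nonpos (by linarith), abs_of_nonpos (by linarith), abs_of_nonpos (by linarith)]; linarith
      · have hh : h x' ≤ h x := hm hx' hx hle
        rw [abs_of_nonneg (by linarith), abs_of_nonneg (by linarith), abs_of_nonneg (by linarith)]; linarith
    · rintro _ ⟨x, hx, rfl⟩
      exact ⟨add_le_add (hD hx).1 (hval x hx).1, add_le_add (hD hx).2 (hval x hx).2⟩
  · -- `φ = x - h x`
    have h := klph_hausdorffMeasure_graph_le_core (h := h) (φ := fun x => x - h x) (D := D) (lo := a - d) (hi := b - c) ?_ ?_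
    · rwa [show b - c - (a - d) = (b - a) + (d - c) by ring] at h
    · intro x hx x' hx'
      rcases le_total x x' with hle | hle
      · have hh : h x' ≤ h x := hm hx hx' hle
        rw [abs_of_nonpos (by linarith : x - x' ≤ 0), abs_of_nonneg (by linarith : 0 ≤ h x - h x'),
          abs_of_nonpos (by linarith : x - h x - (x' - h x') ≤ 0)]; linarith
      · have hh : h x ≤ h x' := hm hx' hx hle
        rw [abs_of_nonneg (by linarith : 0 ≤ x - x'), abs_of_nonpos (by linarith : h x - h x' ≤ 0),
          abs_of_nonneg (by linarith : 0 ≤ x - h x - (x' - h x'))]; linarith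
    · rintro _ ⟨x, hx, rfl⟩
      exact ⟨by linarith [(hD hx).1, (hval x hx).2], by linarith [(hD hx).2, (hval x hx).1]⟩

/-- Composition preserves «monotone or antitone». [folklore] -/
theorem klph_monoOrAnti_comp {f F : ℝ → ℝ} {P T : Set ℝ} (hf : MonotoneOn f P ∨ AntitoneOn f P)
    (hF : MonotoneOn F T ∨ AntitoneOn F T) (hmaps : MapsTo f P T) :
    MonotoneOn (F ∘ f) P ∨ AntitoneOn (F ∘ f) P := by
  rcases hf with hf | hf <;> rcases hF with hF | hF
  · exact Or.inl fun x hx y hy hxy => hF (hmaps hx) (hmaps hy) (hf hx hy hxy)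
  · exact Or.inr fun x hx y hy hxy => hF (hmaps hx) (hmaps hy) (hf hx hy hxy)
  · exact Or.inr fun x hx y hy hxy => hF (hmaps hy) (hmaps hx) (hf hx hy hxy)
  · exact Or.inl fun x hx y hy hxy => hF (hmaps hy) (hmaps hx) (hf hx hy hxy)

/-! ### §2 The `t′` Fermi curve is piecewise a monotone graph -/

/-- **A Möbius function is monotone or antitone off its pole**: `u ↦ (c − u)/(1 + 2su)` on `{0 < 1 + 2su}` and on `{1 + 2su < 0}`. [folklore] -/
theorem klph_mobius_monoOrAnti (s c : ℝ) (T : Set ℝ)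
    (hT : (∀ u ∈ T, 0 < 1 + 2 * s * u) ∨ (∀ u ∈ T, 1 + 2 * s * u < 0)) :
    MonotoneOn (fun u => (c - u) / (1 + 2 * s * u)) T ∨ AntitoneOn (fun u => (c - u) / (1 + 2 * s * u)) T := by
  -- the product of the denominators is positive on `T`
  have hprod : ∀ u ∈ T, ∀ v ∈ T, 0 < (1 + 2 * s * u) * (1 + 2 * s * v) := fun u hu v hv => by
    rcases hT with h | h
    · exact mul_pos (h u hu) (h v hv)
    · exact mul_pos_of_neg_of_neg (h u hu) (h v hv)
  have hne : ∀ u ∈ T, 1 + 2 * s * u ≠ 0 := fun u hu => by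
    rcases hT with h | h
    · exact (h u hu).ne'
    · exact (h u hu).ne
  have hdiff : ∀ u ∈ T, ∀ v ∈ T, (c - v) / (1 + 2 * s * v) - (c - u) / (1 + 2 * s * u) =
      (u - v) * (1 + 2 * s * c) / ((1 + 2 * s * u) * (1 + 2 * s * v)) := fun u hu v hv => by
    rw [div_sub_div _ _ (hne v hv) (hne u hu), div_eq_div_iff (mul_ne_zero (hne v hv) (hne u hu)) (hprod u hu v hv).ne']
    ring
  rcases le_total 0 (1 + 2 * s * c) with hc | hc
  · refine Or.inr fun u hu v hv huv => sub_nonpos.1 ?_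
    rw [hdiff u hu v hv]
    exact div_nonpos_of_nonpos_of_nonneg (mul_nonpos_of_nonpos_of_nonneg (by linarith) hc) (hprod u hu v hv).le
  · refine Or.inl fun u hu v hv huv => sub_nonneg.1 ?_
    rw [hdiff u hu v hv]
    exact div_nonneg (mul_nonneg_of_nonpos_of_nonpos (by linarith) hc) (hprod u hu v hv).le

/-- On `[0, π]` and on `[−π, 0]` the cosine is antitone, resp. monotone. [folklore] -/
theorem klph_cos_monoOrAnti (P : Set ℝ) (hP : P ⊆ Icc 0 π ∨ P ⊆ Icc (-π) 0) : MonotoneOn cos P ∨ AntitoneOn cos P := by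
  rcases hP with hP | hP
  · exact Or.inr (Real.antitoneOn_cos.mono hP)
  · refine Or.inl fun x hx y hy hxy => ?_
    rw [← Real.cos_neg x, ← Real.cos_neg y]
    exact Real.cos_le_cos_of_nonneg_of_le_pi (by linarith [(hP hy).2]) (by linarith [(hP hx).1]) (by linarith)

/-- **`x ↦ ±arccos g(x)`, `g(x) = (c − cos x)/(1 + 2s cos x)`, is monotone or antitone on every piece `P ⊆ [0,π]` or `⊆ [−π,0]` on which `1 + 2s cos x` has a sign.**
[folklore] -/
theorem klph_monoOrAnti_arccos_g (s c σ : ℝ) (hσ : σ = 1 ∨ σ = -1) (P : Set ℝ) (hP : P ⊆ Icc 0 π ∨ P ⊆ Icc (-π) 0)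
    (hA : (∀ x ∈ P, 0 < 1 + 2 * s * cos x) ∨ (∀ x ∈ P, 1 + 2 * s * cos x < 0)) :
    MonotoneOn (fun x => σ * arccos ((c - cos x) / (1 + 2 * s * cos x))) P ∨
      AntitoneOn (fun x => σ * arccos ((c - cos x) / (1 + 2 * s * cos x))) P := by
  set T : Set ℝ := cos '' P with hT
  have hTsign : (∀ u ∈ T, 0 < 1 + 2 * s * u) ∨ (∀ u ∈ T, 1 + 2 * s * u < 0) := by
    rcases hA with h | h
    · exact Or.inl (by rintro _ ⟨x, hx, rfl⟩; exact h x hx)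
    · exact Or.inr (by rintro _ ⟨x, hx, rfl⟩; exact h x hx)
  have h1 : MonotoneOn ((fun u => (c - u) / (1 + 2 * s * u)) ∘ cos) P ∨ AntitoneOn ((fun u => (c - u) / (1 + 2 * s * u)) ∘ cos) P :=
    klph_monoOrAnti_comp (klph_cos_monoOrAnti P hP) (klph_mobius_monoOrAnti s c T hTsign) (fun x hx => ⟨x, hx, rfl⟩)
  have h2 : MonotoneOn (arccos ∘ ((fun u => (c - u) / (1 + 2 * s * u)) ∘ cos)) P ∨
      AntitoneOn (arccos ∘ ((fun u => (c - u) / (1 + 2 * s * u)) ∘ cos)) P :=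
    klph_monoOrAnti_comp h1 (Or.inr (Real.antitone_arccos.antitoneOn univ)) (fun x _ => mem_univ _)
  have hσma : MonotoneOn (fun y : ℝ => σ * y) univ ∨ AntitoneOn (fun y : ℝ => σ * y) univ := by
    rcases hσ with rfl | rfl
    · exact Or.inl fun x _ y _ hxy => by linarith
    · exact Or.inr fun x _ y _ hxy => by linarith
  have h3 := klph_monoOrAnti_comp h2 hσma (fun x _ => mem_univ _)
  exact h3

/-- **On the Fermi curve of the `t`–`t′` band, `cos k₁ · (1 + 2t′ cos k₀) = −μ/2 − cos k₀`.** [folklore] -/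
theorem klph_fermiCurve_relation {tp μ : ℝ} {k : Momentum} (hk : k ∈ fermiCurve (squareDispersion 1 tp) μ) :
    cos (k 1) * (1 + 2 * tp * cos (k 0)) = -μ / 2 - cos (k 0) := by
  have h := hk.2
  simp only [squareDispersion] at h
  linarith

/-! ### §3 Finite length of every `t′` Fermi curve -/

/-- A vertical segment `{x₀} × [−π, π]` has length `μH[1] ≤ 2π`. [folklore] -/
theorem klph_hausdorffMeasure_vertical_le (x₀ : ℝ) :
    μH[1] ((fun y => (WithLp.toLp 2 ![x₀, y] : Momentum)) '' Icc (-π) π) ≤ ENNReal.ofReal (2 * π) := by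
  have hL : LipschitzOnWith 1 (fun y => (WithLp.toLp 2 ![x₀, y] : Momentum)) (Icc (-π) π) := by
    refine LipschitzOnWith.of_dist_le_mul fun y _ y' _ => ?_
    simp only [NNReal.coe_one, one_mul, Real.dist_eq]
    calc dist (WithLp.toLp 2 ![x₀, y] : Momentum) (WithLp.toLp 2 ![x₀, y']) ≤ |x₀ - x₀| + |y - y'| := kl_hf_dist_mk_le _ _ _ _
      _ = |y - y'| := by rw [sub_self, abs_zero, zero_add]
  refine (klph_hausdorffMeasure_image_Icc_le hL).trans ?_
  rw [ENNReal.coe_one, one_mul, show π - -π = 2 * π by ring]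

/-- One graph piece of the Fermi curve: for `P ⊆ [0,π]` or `⊆ [−π,0]` with a sign of `1 + 2t′cos x`, the arc `{(x, σ·arccos g(x)) : x ∈ P}` (`σ = ±1`)
has `μH[1] ≤ 2π`. [folklore] -/
theorem klph_hausdorffMeasure_piece_le (s c σ : ℝ) (hσ : σ = 1 ∨ σ = -1) (P : Set ℝ) (hP : P ⊆ Icc 0 π ∨ P ⊆ Icc (-π) 0)
    (hA : (∀ x ∈ P, 0 < 1 + 2 * s * cos x) ∨ (∀ x ∈ P, 1 + 2 * s * cos x < 0)) :
    μH[1] ((fun x => (WithLp.toLp 2 ![x, σ * arccos ((c - cos x) / (1 + 2 * s * cos x))] : Momentum)) '' P) ≤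
      ENNReal.ofReal (2 * π) := by
  have hπ := Real.pi_pos
  have hm := klph_monoOrAnti_arccos_g s c σ hσ P hP hA
  rcases hP with hP | hP
  · rcases hσ with rfl | rfl
    · have h := klph_hausdorffMeasure_graph_le (a := 0) (b := π) (c := 0) (d := π) hP
        (fun x _ => by rw [one_mul]; exact ⟨arccos_nonneg _, arccos_le_pi _⟩) hm
      rwa [show π - 0 + (π - 0) = 2 * π by ring] at h
    · have h := klph_hausdorffMeasure_graph_le (a := 0) (b := π) (c := -π) (d := 0) hP
        (fun x _ => ⟨by linarith [arccos_le_pi ((c - cos x) / (1 + 2 * s * cos x))],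
          by linarith [arccos_nonneg ((c - cos x) / (1 + 2 * s * cos x))]⟩) hm
      rwa [show π - 0 + (0 - -π) = 2 * π by ring] at h
  · rcases hσ with rfl | rfl
    · have h := klph_hausdorffMeasure_graph_le (a := -π) (b := 0) (c := 0) (d := π) hP
        (fun x _ => by rw [one_mul]; exact ⟨arccos_nonneg _, arccos_le_pi _⟩) hm
      rwa [show 0 - -π + (π - 0) = 2 * π by ring] at h
    · have h := klph_hausdorffMeasure_graph_le (a := -π) (b := 0) (c := -π) (d := 0) hP
        (fun x _ => ⟨by linarith [arccos_le_pi ((c - cos x) / (1 + 2 * s * cos x))],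
          by linarith [arccos_nonneg ((c - cos x) / (1 + 2 * s * cos x))]⟩) hm
      rwa [show 0 - -π + (0 - -π) = 2 * π by ring] at h

/-- `μH[1] (X ∪ Y) ≤ a + b` from bounds on the parts. [folklore] -/
theorem klph_hausdorffMeasure_union_le {X Y : Set Momentum} {a b : ℝ≥0∞} (hX : μH[1] X ≤ a) (hY : μH[1] Y ≤ b) :
    μH[1] (X ∪ Y) ≤ a + b :=
  (measure_union_le X Y).trans (add_le_add hX hY)

/-- **THE COVER**: every point of the Fermi curve of `ε_{t′}` at level `μ` lies on one of eight monotone-graph arcs `k₁ = ±arccos g(k₀)` over the pieces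
`{k₀ ∈ [0,π] or [−π,0]} ∩ {1 + 2t′cos k₀ ≷ 0}`, or on one of the two vertical segments at `cos k₀ = −1/(2t′)`. [folklore] -/
theorem klph_fermiCurve_subset_cover (tp μ : ℝ) :
    fermiCurve (squareDispersion 1 tp) μ ⊆
      ((((((fun x => (WithLp.toLp 2 ![x, 1 * arccos ((-μ / 2 - cos x) / (1 + 2 * tp * cos x))] : Momentum)) '' {x | x ∈ Icc 0 π ∧ 0 < 1 + 2 * tp * cos x}) ∪
          ((fun x => (WithLp.toLp 2 ![x, 1 * arccos ((-μ / 2 - cos x) / (1 + 2 * tp * cos x))] : Momentum)) '' {x | x ∈ Icc 0 π ∧ 1 + 2 * tp * cos x < 0})) ∪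
         (((fun x => (WithLp.toLp 2 ![x, 1 * arccos ((-μ / 2 - cos x) / (1 + 2 * tp * cos x))] : Momentum)) '' {x | x ∈ Icc (-π) 0 ∧ 0 < 1 + 2 * tp * cos x}) ∪
          ((fun x => (WithLp.toLp 2 ![x, 1 * arccos ((-μ / 2 - cos x) / (1 + 2 * tp * cos x))] : Momentum)) '' {x | x ∈ Icc (-π) 0 ∧ 1 + 2 * tp * cos x < 0}))) ∪
        (((((fun x => (WithLp.toLp 2 ![x, (-1) * arccos ((-μ / 2 - cos x) / (1 + 2 * tp * cos x))] : Momentum)) '' {x | x ∈ Icc 0 π ∧ 0 < 1 + 2 * tp * cos x}) ∪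
          ((fun x => (WithLp.toLp 2 ![x, (-1) * arccos ((-μ / 2 - cos x) / (1 + 2 * tp * cos x))] : Momentum)) '' {x | x ∈ Icc 0 π ∧ 1 + 2 * tp * cos x < 0})) ∪
         (((fun x => (WithLp.toLp 2 ![x, (-1) * arccos ((-μ / 2 - cos x) / (1 + 2 * tp * cos x))] : Momentum)) '' {x | x ∈ Icc (-π) 0 ∧ 0 < 1 + 2 * tp * cos x}) ∪
          ((fun x => (WithLp.toLp 2 ![x, (-1) * arccos ((-μ / 2 - cos x) / (1 + 2 * tp * cos x))] : Momentum)) '' {x | x ∈ Icc (-π) 0 ∧ 1 + 2 * tp * cos x < 0}))))) ∪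
       (((fun y => (WithLp.toLp 2 ![arccos (-1 / (2 * tp)), y] : Momentum)) '' Icc (-π) π) ∪
        ((fun y => (WithLp.toLp 2 ![-arccos (-1 / (2 * tp)), y] : Momentum)) '' Icc (-π) π))) := by
  intro k hk
  have hk0 : k 0 ∈ Ico (-π) π := hk.1 0
  have hk1 : k 1 ∈ Ico (-π) π := hk.1 1
  have hrel := klph_fermiCurve_relation hk
  have hkext : ∀ a b : ℝ, k 0 = a → k 1 = b → k = WithLp.toLp 2 ![a, b] := fun a b ha hb => by
    ext i; fin_cases i <;> simp [ha, hb]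
  by_cases hA : 1 + 2 * tp * cos (k 0) = 0
  · -- the exceptional abscissa: a vertical segment
    have htp : tp ≠ 0 := by rintro rfl; norm_num at hA
    have hcos : cos (k 0) = -1 / (2 * tp) := by field_simp; linarith
    have habs : arccos (-1 / (2 * tp)) = |k 0| := by
      rw [← hcos, ← Real.cos_abs, arccos_cos (abs_nonneg _) (abs_le.2 ⟨by linarith [hk0.1], hk0.2.le⟩)]
    rcases le_or_gt 0 (k 0) with h0 | h0
    · have hmem : k ∈ ((fun y => (WithLp.toLp 2 ![arccos (-1 / (2 * tp)), y] : Momentum)) '' Icc (-π) π) := by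
        refine ⟨k 1, ⟨hk1.1, hk1.2.le⟩, (hkext _ _ ?_ rfl).symm⟩
        rw [habs, abs_of_nonneg h0]
      exact Or.inr (Or.inl hmem)
    · have hmem : k ∈ ((fun y => (WithLp.toLp 2 ![-arccos (-1 / (2 * tp)), y] : Momentum)) '' Icc (-π) π) := by
        refine ⟨k 1, ⟨hk1.1, hk1.2.le⟩, (hkext _ _ ?_ rfl).symm⟩
        rw [habs, abs_of_neg h0, neg_neg]
      exact Or.inr (Or.inr hmem)
  · -- a graph point
    have hg : cos (k 1) = (-μ / 2 - cos (k 0)) / (1 + 2 * tp * cos (k 0)) := by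
      rw [eq_div_iff hA]; exact hrel
    have hk1p : 0 ≤ k 1 → k 1 = 1 * arccos ((-μ / 2 - cos (k 0)) / (1 + 2 * tp * cos (k 0))) := fun h1 => by
      rw [one_mul, ← hg, arccos_cos h1 hk1.2.le]
    have hk1m : k 1 < 0 → k 1 = (-1) * arccos ((-μ / 2 - cos (k 0)) / (1 + 2 * tp * cos (k 0))) := fun h1 => by
      rw [← hg, ← Real.cos_neg, arccos_cos (by linarith) (by linarith [hk1.1])]; ring
    left
    rcases le_or_gt 0 (k 1) with h1 | h1 <;> rcases le_or_gt 0 (k 0) with h0 | h0 <;> rcases lt_or_gt_of_ne hA with hs | hs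
    · exact Or.inl (Or.inl (Or.inr ⟨k 0, ⟨⟨h0, hk0.2.le⟩, hs⟩, (hkext _ _ rfl (hk1p h1)).symm⟩))
    · exact Or.inl (Or.inl (Or.inl ⟨k 0, ⟨⟨h0, hk0.2.le⟩, hs⟩, (hkext _ _ rfl (hk1p h1)).symm⟩))
    · exact Or.inl (Or.inr (Or.inr ⟨k 0, ⟨⟨hk0.1, h0.le⟩, hs⟩, (hkext _ _ rfl (hk1p h1)).symm⟩))
    · exact Or.inl (Or.inr (Or.inl ⟨k 0, ⟨⟨hk0.1, h0.le⟩, hs⟩, (hkext _ _ rfl (hk1p h1)).symm⟩))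
    · exact Or.inr (Or.inl (Or.inr ⟨k 0, ⟨⟨h0, hk0.2.le⟩, hs⟩, (hkext _ _ rfl (hk1m h1)).symm⟩))
    · exact Or.inr (Or.inl (Or.inl ⟨k 0, ⟨⟨h0, hk0.2.le⟩, hs⟩, (hkext _ _ rfl (hk1m h1)).symm⟩))
    · exact Or.inr (Or.inr (Or.inr ⟨k 0, ⟨⟨hk0.1, h0.le⟩, hs⟩, (hkext _ _ rfl (hk1m h1)).symm⟩))
    · exact Or.inr (Or.inr (Or.inl ⟨k 0, ⟨⟨hk0.1, h0.le⟩, hs⟩, (hkext _ _ rfl (hk1m h1)).symm⟩))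

/-- **EVERY `t`–`t′` FERMI CURVE HAS FINITE LENGTH**: `μH[1] (fermiCurve (squareDispersion 1 tp) μ) ≤ 10·(2π)` for every `tp`, `μ` (eight monotone arcs
and two vertical segments of length `≤ 2π` each). [cite: RaghuKivelsonScalapino2010, §II (6)] -/
theorem klph_hausdorffMeasure_fermiCurve_le (tp μ : ℝ) :
    μH[1] (fermiCurve (squareDispersion 1 tp) μ) ≤ 10 * ENNReal.ofReal (2 * π) := by
  have h01 : ({x | x ∈ Icc 0 π ∧ 0 < 1 + 2 * tp * cos x} : Set ℝ) ⊆ Icc 0 π ∨ ({x | x ∈ Icc 0 π ∧ 0 < 1 + 2 * tp * cos x} : Set ℝ) ⊆ Icc (-π) 0 :=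
    Or.inl fun x hx => hx.1
  have h02 : ({x | x ∈ Icc 0 π ∧ 1 + 2 * tp * cos x < 0} : Set ℝ) ⊆ Icc 0 π ∨ ({x | x ∈ Icc 0 π ∧ 1 + 2 * tp * cos x < 0} : Set ℝ) ⊆ Icc (-π) 0 :=
    Or.inl fun x hx => hx.1
  have h03 : ({x | x ∈ Icc (-π) 0 ∧ 0 < 1 + 2 * tp * cos x} : Set ℝ) ⊆ Icc 0 π ∨ ({x | x ∈ Icc (-π) 0 ∧ 0 < 1 + 2 * tp * cos x} : Set ℝ) ⊆ Icc (-π) 0 :=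
    Or.inr fun x hx => hx.1
  have h04 : ({x | x ∈ Icc (-π) 0 ∧ 1 + 2 * tp * cos x < 0} : Set ℝ) ⊆ Icc 0 π ∨ ({x | x ∈ Icc (-π) 0 ∧ 1 + 2 * tp * cos x < 0} : Set ℝ) ⊆ Icc (-π) 0 :=
    Or.inr fun x hx => hx.1
  have hs1 : (∀ x ∈ ({x | x ∈ Icc 0 π ∧ 0 < 1 + 2 * tp * cos x} : Set ℝ), 0 < 1 + 2 * tp * cos x) ∨
      (∀ x ∈ ({x | x ∈ Icc 0 π ∧ 0 < 1 + 2 * tp * cos x} : Set ℝ), 1 + 2 * tp * cos x < 0) := Or.inl fun x hx => hx.2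
  have hs2 : (∀ x ∈ ({x | x ∈ Icc 0 π ∧ 1 + 2 * tp * cos x < 0} : Set ℝ), 0 < 1 + 2 * tp * cos x) ∨
      (∀ x ∈ ({x | x ∈ Icc 0 π ∧ 1 + 2 * tp * cos x < 0} : Set ℝ), 1 + 2 * tp * cos x < 0) := Or.inr fun x hx => hx.2
  have hs3 : (∀ x ∈ ({x | x ∈ Icc (-π) 0 ∧ 0 < 1 + 2 * tp * cos x} : Set ℝ), 0 < 1 + 2 * tp * cos x) ∨
      (∀ x ∈ ({x | x ∈ Icc (-π) 0 ∧ 0 < 1 + 2 * tp * cos x} : Set ℝ), 1 + 2 * tp * cos x < 0) := Or.inl fun x hx => hx.2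
  have hs4 : (∀ x ∈ ({x | x ∈ Icc (-π) 0 ∧ 1 + 2 * tp * cos x < 0} : Set ℝ), 0 < 1 + 2 * tp * cos x) ∨
      (∀ x ∈ ({x | x ∈ Icc (-π) 0 ∧ 1 + 2 * tp * cos x < 0} : Set ℝ), 1 + 2 * tp * cos x < 0) := Or.inr fun x hx => hx.2
  have hp : (1 : ℝ) = 1 ∨ (1 : ℝ) = -1 := Or.inl rfl
  have hm : (-1 : ℝ) = 1 ∨ (-1 : ℝ) = -1 := Or.inr rfl
  refine (measure_mono (klph_fermiCurve_subset_cover tp μ)).trans ?_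
  refine (klph_hausdorffMeasure_union_le
    (klph_hausdorffMeasure_union_le
      (klph_hausdorffMeasure_union_le
        (klph_hausdorffMeasure_union_le (klph_hausdorffMeasure_piece_le tp (-μ / 2) 1 hp _ h01 hs1)
          (klph_hausdorffMeasure_piece_le tp (-μ / 2) 1 hp _ h02 hs2))
        (klph_hausdorffMeasure_union_le (klph_hausdorffMeasure_piece_le tp (-μ / 2) 1 hp _ h03 hs3)
          (klph_hausdorffMeasure_piece_le tp (-μ / 2) 1 hp _ h04 hs4)))
      (klph_hausdorffMeasure_union_le
        (klph_hausdorffMeasure_union_le (klph_hausdorffMeasure_piece_le tp (-μ / 2) (-1) hm _ h01 hs1)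
          (klph_hausdorffMeasure_piece_le tp (-μ / 2) (-1) hm _ h02 hs2))
        (klph_hausdorffMeasure_union_le (klph_hausdorffMeasure_piece_le tp (-μ / 2) (-1) hm _ h03 hs3)
          (klph_hausdorffMeasure_piece_le tp (-μ / 2) (-1) hm _ h04 hs4))))
    (klph_hausdorffMeasure_union_le (klph_hausdorffMeasure_vertical_le _) (klph_hausdorffMeasure_vertical_le _))).trans ?_
  apply le_of_eq
  ring

/-- **… hence finite**: `μH[1] (fermiCurve (squareDispersion 1 tp) μ) < ∞` for every `tp`, `μ`. [cite: RaghuKivelsonScalapino2010, §II (6)] -/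
theorem klph_hausdorffMeasure_fermiCurve_lt_top (tp μ : ℝ) :
    μH[1] (fermiCurve (squareDispersion 1 tp) μ) < ⊤ :=
  (klph_hausdorffMeasure_fermiCurve_le tp μ).trans_lt (ENNReal.mul_lt_top (by norm_num) ENNReal.ofReal_lt_top)

/-- **The Fermi-curve measure of the `t`–`t′` band is finite from a speed floor alone** (the finite length being a theorem): a certified `w > 0` with
`w ≤ (2 sin k₀ (1 + 2t′cos k₁))² + (2 sin k₁ (1 + 2t′cos k₀))²` on the Fermi curve gives `IsFiniteMeasure σ[ε_{t′}, μ]`.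
[cite: RaghuKivelsonScalapino2010, §II (6)] -/
theorem klph_isFiniteMeasure_tp_of_speedSqFloor' (tp μ : ℝ) {w : ℝ} (hw : 0 < w)
    (hspeed : ∀ k ∈ fermiCurve (squareDispersion 1 tp) μ,
      w ≤ (2 * sin (k 0) * (1 + 2 * tp * cos (k 1))) ^ 2 + (2 * sin (k 1) * (1 + 2 * tp * cos (k 0))) ^ 2) :
    IsFiniteMeasure (fermiCurveMeasure (squareDispersion 1 tp) μ) :=
  klph_isFiniteMeasure_tp_of_speedSqFloor tp μ hw hspeed (klph_hausdorffMeasure_fermiCurve_lt_top tp μ)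

end Summit.HubbardSuperconductivity.HubbardSuperconductivity.Theorems

end
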